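import Literature.Probability.RandomPlanarGeometry.LoewnerGrowth
import Literature.Probability.RandomPlanarGeometry.LoewnerSemigroup
import Literature.Probability.RandomPlanarGeometry.SLERestrictionMartingale
import HarnessLib

/-!
# Two-sided tubes for the Loewner flow and the cocycle of slid hulls

Deterministic Loewner calculus for [LSW] §5 (the hull `A_t = g_t(A)` seen from the tip,
`B_t = A_t - W_t = Loewner.slidHull W A t`):

* `le_norm_sub_of_near_end_aux` — a **backward barrier lemma**: a path with speed
  `≤ 2/dist(path, driver)` that ends at distance `≥ m` from the driver at time `b` was at
  distance `> m/2` during `[a, b]` and moved by `≤ 4(b - v)/m`, provided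
  `4(b - a)/m + osc_{[a,b]} V < m/2` (first-exit argument run backwards from `b`);
* `norm_map_sub_ge_of_before` / `norm_map_sub_ge_of_after` — the **two-sided tube** for the
  Loewner flow of one point: if `|g_s(z) - W_s| ≥ m` then for the times `v` before (resp. after)
  `s` in the lifetime with `4|s - v|/m + osc W < m/2`: `|g_v(z) - W_v| > m/2` and
  `|g_v(z) - g_s(z)| ≤ 4|s - v|/m`;
* `slidHull_add` — the **cocycle of slid hulls**: `B_{s+u} = slidHull (W(s+·) - W_s) B_s u`
  (Lawler's `g_{s+u} = g_{s,s+u} ∘ g_s`, Rem. 4.9, and translation invariance), for `A` alive at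
  time `s + u`.

## References

* G. F. Lawler, *Conformally Invariant Processes in the Plane* (2005), Lemma 4.13, Rem. 4.9
  [Lawler2005].
* G. F. Lawler, O. Schramm, W. Werner, *Conformal restriction: the chordal case* (2003), §5
  [LawlerSchrammWerner2003Restriction].
-/

noncomputable section

open Set Filter Metric Function
open _root_.Complex _root_.Topology
open UpperHalfPlane (upperHalfPlaneSet)
open scoped NNReal

namespace Literature.Probability.RandomPlanarGeometry

namespace Loewner

variable {W : ℝ≥0 → ℝ} {A : Set ℂ} {z : ℂ}

/-! ### The backward barrier lemma -/

/-- **Backward first-exit bootstrap.** Let `f` be continuous on `[a, b]` with right derivatives of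
norm `≤ 2/‖f v - V v‖` on `[a, b)`, `V` continuous on `[a, b]` with `‖V v - V b‖ ≤ Ω`, and
`‖f b - V b‖ ≥ m > 0`. If `4(b - a)/m + Ω < m/2`, then on `[a, b]` the path stays `m/2`-away from
the driver and `‖f b - f v‖ ≤ (4/m)(b - v)`. (At the last time `v₀ < b` when the distance is
`≤ m/2`, the displacement over `[v₀, b]` is `≤ 4(b-a)/m`, so the distance at `b` would be
`< m`.) [cite: Lawler2005, Lemma 4.13 (proof, run backwards)] -/
theorem le_norm_sub_of_near_end_aux {f V : ℝ → ℂ} {f' : ℝ → ℂ} {a b m Ω : ℝ}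
    (hfc : ContinuousOn f (Icc a b)) (hVc : ContinuousOn V (Icc a b))
    (hf' : ∀ v ∈ Ico a b, HasDerivWithinAt f (f' v) (Ici v) v)
    (hbound : ∀ v ∈ Ico a b, ‖f' v‖ ≤ 2 / ‖f v - V v‖)
    (hΩ : ∀ v ∈ Icc a b, ‖V v - V b‖ ≤ Ω) (hm : 0 < m) (hmb : m ≤ ‖f b - V b‖)
    (hsmall : 4 * (b - a) / m + Ω < m / 2) :
    ∀ v ∈ Icc a b, m / 2 < ‖f v - V v‖ ∧ ‖f b - f v‖ ≤ 4 / m * (b - v) := by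
  -- displacement over `[u, b]` from a distance bound on `[u, b)`
  have hdisp : ∀ u ∈ Icc a b, (∀ v ∈ Ico u b, m / 2 ≤ ‖f v - V v‖) →
      ‖f b - f u‖ ≤ 4 / m * (b - u) := by
    intro u hu hfar
    refine norm_image_sub_le_of_norm_deriv_right_le_segment (f := f) (f' := f') (a := u) (b := b)
      (C := 4 / m) (hfc.mono (Icc_subset_Icc_left hu.1)) (fun v hv ↦ hf' v ⟨hu.1.trans hv.1, hv.2⟩)
      (fun v hv ↦ (hbound v ⟨hu.1.trans hv.1, hv.2⟩).trans ?_) b ⟨hu.2, le_rfl⟩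
    have := hfar v hv
    rw [div_le_div_iff₀ (by linarith) hm]
    linarith
  -- distance at `u` from the displacement bound
  have hdist : ∀ u ∈ Icc a b, ‖f b - f u‖ ≤ 4 / m * (b - u) → m / 2 < ‖f u - V u‖ := by
    intro u hu hd
    have h1 : 4 / m * (b - u) ≤ 4 * (b - a) / m := by
      rw [div_mul_eq_mul_div]
      exact div_le_div_of_nonneg_right (by nlinarith [hu.1]) hm.le
    have h2 : ‖f b - V b‖ ≤ ‖f u - V u‖ + ‖f b - f u‖ + ‖V u - V b‖ := by
      calc ‖f b - V b‖ = ‖(f u - V u) + (f b - f u) + (V u - V b)‖ := by ring_nf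
        _ ≤ ‖(f u - V u) + (f b - f u)‖ + ‖V u - V b‖ := norm_add_le _ _
        _ ≤ ‖f u - V u‖ + ‖f b - f u‖ + ‖V u - V b‖ := by gcongr; exact norm_add_le _ _
    have h3 := hΩ u hu
    linarith
  -- no last bad time
  have hall : ∀ v ∈ Icc a b, m / 2 < ‖f v - V v‖ := by
    by_contra hcon
    push Not at hcon
    set B : Set ℝ := {v ∈ Icc a b | ‖f v - V v‖ ≤ m / 2} with hB
    have hBne : B.Nonempty := by
      obtain ⟨v, hv, hle⟩ := hcon
      exact ⟨v, hv, hle⟩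
    have hcont : ContinuousOn (fun v ↦ ‖f v - V v‖) (Icc a b) := (hfc.sub hVc).norm
    have hBclosed : IsClosed B := hcont.preimage_isClosed_of_isClosed isClosed_Icc isClosed_Iic
    have hBbdd : BddAbove B := ⟨b, fun v hv ↦ hv.1.2⟩
    set v₀ := sSup B with hv₀
    have hv₀B : v₀ ∈ B := hBclosed.csSup_mem hBne hBbdd
    have hbB : b ∉ B := fun h ↦ by have := h.2; linarith
    have hv₀b : v₀ < b := lt_of_le_of_ne hv₀B.1.2 fun h ↦ hbB (h ▸ hv₀B)
    have hright : ∀ v ∈ Ioo v₀ b, m / 2 < ‖f v - V v‖ := by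
      intro v hv
      by_contra hle
      push Not at hle
      have hvB : v ∈ B := ⟨⟨hv₀B.1.1.trans hv.1.le, hv.2.le⟩, hle⟩
      exact (lt_irrefl _ (hv.1.trans_le (le_csSup hBbdd hvB)))
    -- at `v₀` the distance is exactly `m/2` (it cannot be smaller, by continuity)
    have hv₀ge : m / 2 ≤ ‖f v₀ - V v₀‖ := by
      by_contra hlt
      push Not at hlt
      have hcw : ContinuousWithinAt (fun v ↦ ‖f v - V v‖) (Icc a b) v₀ := hcont v₀ hv₀B.1
      rw [Metric.continuousWithinAt_iff] at hcw
      obtain ⟨δ, hδ, hδv⟩ := hcw (m / 2 - ‖f v₀ - V v₀‖) (by linarith)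
      set v : ℝ := min (v₀ + δ / 2) ((v₀ + b) / 2) with hvdef
      have hv1 : v₀ < v := by rw [hvdef]; exact lt_min (by linarith) (by linarith)
      have hv2 : v < b := lt_of_le_of_lt (min_le_right _ _) (by linarith)
      have hv3 : v ∈ Icc a b := ⟨hv₀B.1.1.trans hv1.le, hv2.le⟩
      have hv4 : dist v v₀ < δ := by
        rw [Real.dist_eq, abs_of_pos (by linarith)]
        have := min_le_left (v₀ + δ / 2) ((v₀ + b) / 2)
        linarith
      have h := hδv hv3 hv4
      rw [Real.dist_eq, abs_lt] at h
      have := hright v ⟨hv1, hv2⟩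
      linarith [h.2]
    have hd := hdisp v₀ hv₀B.1 fun v hv ↦ by
      rcases hv.1.eq_or_lt with h | h
      · rw [← h]; exact hv₀ge
      · exact (hright v ⟨h, hv.2⟩).le
    have := hdist v₀ hv₀B.1 hd
    linarith [hv₀B.2]
  intro v hv
  exact ⟨hall v hv, hdisp v hv fun w hw ↦ (hall w ⟨hv.1.trans hw.1, hw.2.le⟩).le⟩


/-! ### The two-sided tube for the flow of one point -/

/-- The vector field has norm `2/‖g - W‖`. [folklore] -/
theorem norm_vectorField (W : ℝ≥0 → ℝ) (t : ℝ) (w : ℂ) :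
    ‖vectorField W t w‖ = 2 / ‖w - W t.toNNReal‖ := by
  rw [vectorField_apply, norm_div, Complex.norm_two]

/-- **Backward tube**: if `|g_s(z) - W_s| ≥ m > 0` and, on `[v, s]`, the driver oscillates by at most
`Ω` with `4(s - v)/m + Ω < m/2`, then for every `r ∈ [v, s]`: `|g_r(z) - W_r| > m/2` and
`|g_s(z) - g_r(z)| ≤ 4(s - r)/m`. [cite: Lawler2005, Lemma 4.13 (proof)] -/
theorem norm_map_sub_ge_of_before (hW : Continuous W) {s v : ℝ≥0}
    (hs : (s : WithTop ℝ≥0) < swallowingTime W z) {m Ω : ℝ} (hm : 0 < m)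
    (hms : m ≤ ‖map W s z - W s‖) (hΩ : ∀ r : ℝ≥0, v ≤ r → r ≤ s → |W r - W s| ≤ Ω)
    (hsmall : 4 * ((s : ℝ) - v) / m + Ω < m / 2) {r : ℝ≥0} (hvr : v ≤ r) (hrs : r ≤ s) :
    m / 2 < ‖map W r z - W r‖ ∧ ‖map W s z - map W r z‖ ≤ 4 / m * ((s : ℝ) - r) := by
  have hz : z ≠ W 0 := ne_driving_of_lt_swallowingTime hs
  obtain ⟨G, hG⟩ := exists_isSolution_swallowingTime_holds hW hz
  have hs' : (((s : ℝ).toNNReal : ℝ≥0) : WithTop ℝ≥0) < swallowingTime W z := by simpa using hs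
  have hsub := Icc_subset_timeDomain hs'
  have hmapG : ∀ r : ℝ≥0, r ≤ s → map W r z = G r := fun r hr ↦
    map_eq_of_isSolution hW hG (lt_of_le_of_lt (by exact_mod_cast hr) hs)
  set V : ℝ → ℂ := fun r ↦ ((W r.toNNReal : ℝ) : ℂ) with hV
  have key := le_norm_sub_of_near_end_aux (f := G) (V := V) (f' := fun r ↦ vectorField W r (G r))
    (a := v) (b := s) (m := m) (Ω := Ω)
    (hG.continuousOn.mono ((Icc_subset_Icc_left v.coe_nonneg).trans hsub))
    ((Complex.continuous_ofReal.comp (hW.comp continuous_real_toNNReal)).continuousOn)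
    (fun r hr ↦ hG.hasDerivWithinAt_Ici hsub r ⟨v.coe_nonneg.trans hr.1, hr.2⟩)
    (fun r hr ↦ by rw [norm_vectorField])
    (fun r hr ↦ by
      have h0 : 0 ≤ r := v.coe_nonneg.trans hr.1
      have := hΩ r.toNNReal (by rw [← NNReal.coe_le_coe, Real.coe_toNNReal r h0]; exact hr.1)
        (by rw [← NNReal.coe_le_coe, Real.coe_toNNReal r h0]; exact hr.2)
      rw [hV]
      simp only [Real.toNNReal_coe]
      rw [← Complex.ofReal_sub, Complex.norm_real, Real.norm_eq_abs]
      exact this)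
    hm (by simpa [hV, ← hmapG s le_rfl] using hms) hsmall r ⟨by exact_mod_cast hvr, by exact_mod_cast hrs⟩
  simp only [hV, Real.toNNReal_coe] at key
  rwa [hmapG r hrs, hmapG s le_rfl]

/-- **Forward tube**: if `|g_s(z) - W_s| ≥ m > 0`, `v ≥ s` is in the lifetime and, on `[s, v]`, the
driver oscillates by at most `Ω` with `4(v - s)/m + Ω < m/2`, then for every `r ∈ [s, v]`:
`|g_r(z) - W_r| > m/2` and `|g_r(z) - g_s(z)| ≤ 4(r - s)/m` (the barrier lemma for the reversed
path). [cite: Lawler2005, Lemma 4.13 (proof)] -/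
theorem norm_map_sub_ge_of_after (hW : Continuous W) {s v : ℝ≥0} (hsv : s ≤ v)
    (hv : (v : WithTop ℝ≥0) < swallowingTime W z) {m Ω : ℝ} (hm : 0 < m)
    (hms : m ≤ ‖map W s z - W s‖) (hΩ : ∀ r : ℝ≥0, s ≤ r → r ≤ v → |W r - W s| ≤ Ω)
    (hsmall : 4 * ((v : ℝ) - s) / m + Ω < m / 2) {r : ℝ≥0} (hsr : s ≤ r) (hrv : r ≤ v) :
    m / 2 < ‖map W r z - W r‖ ∧ ‖map W r z - map W s z‖ ≤ 4 / m * ((r : ℝ) - s) := by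
  have hz : z ≠ W 0 := ne_driving_of_lt_swallowingTime hv
  obtain ⟨G, hG⟩ := exists_isSolution_swallowingTime_holds hW hz
  have hv' : (((v : ℝ).toNNReal : ℝ≥0) : WithTop ℝ≥0) < swallowingTime W z := by simpa using hv
  have hsub := Icc_subset_timeDomain hv'
  have hmapG : ∀ r : ℝ≥0, r ≤ v → map W r z = G r := fun r hr ↦
    map_eq_of_isSolution hW hG (lt_of_le_of_lt (by exact_mod_cast hr) hv)
  -- the reversed path on `[-v, -s]`
  set f : ℝ → ℂ := fun ρ ↦ G (-ρ) with hf
  set V : ℝ → ℂ := fun ρ ↦ ((W (-ρ).toNNReal : ℝ) : ℂ) with hV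
  have hfc : ContinuousOn f (Icc (-(v : ℝ)) (-s)) := by
    refine (hG.continuousOn.comp continuous_neg.continuousOn fun ρ hρ ↦ hsub ?_)
    exact ⟨by linarith [hρ.2, s.coe_nonneg], by linarith [hρ.1]⟩
  have hVc : ContinuousOn V (Icc (-(v : ℝ)) (-s)) :=
    ((Complex.continuous_ofReal.comp (hW.comp continuous_real_toNNReal)).comp continuous_neg).continuousOn
  have hf' : ∀ ρ ∈ Ico (-(v : ℝ)) (-s), HasDerivWithinAt f (-vectorField W (-ρ) (G (-ρ))) (Ici ρ) ρ := by
    intro ρ hρ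
    have hpos : 0 < -ρ := by linarith [hρ.2, s.coe_nonneg]
    have hT : ((-ρ).toNNReal : WithTop ℝ≥0) < swallowingTime W z := (hsub ⟨hpos.le, by linarith [hρ.1]⟩).2
    have h1 := hG.hasDerivAt hpos hT
    have h2 : HasDerivAt f (-vectorField W (-ρ) (G (-ρ))) ρ := by
      have := h1.scomp ρ (hasDerivAt_neg ρ)
      rw [neg_one_smul] at this
      exact this
    exact h2.hasDerivWithinAt
  have key := le_norm_sub_of_near_end_aux (f := f) (V := V) (f' := fun ρ ↦ -vectorField W (-ρ) (G (-ρ)))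
    (a := -(v : ℝ)) (b := -s) (m := m) (Ω := Ω) hfc hVc hf'
    (fun ρ hρ ↦ by rw [norm_neg, norm_vectorField])
    (fun ρ hρ ↦ by
      have h0 : 0 ≤ -ρ := by linarith [hρ.2, s.coe_nonneg]
      have := hΩ (-ρ).toNNReal (by rw [← NNReal.coe_le_coe, Real.coe_toNNReal _ h0]; linarith [hρ.2])
        (by rw [← NNReal.coe_le_coe, Real.coe_toNNReal _ h0]; linarith [hρ.1])
      rw [hV]
      simp only [neg_neg, Real.toNNReal_coe]
      rw [← Complex.ofReal_sub, Complex.norm_real, Real.norm_eq_abs]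
      exact this)
    hm (by simpa [hf, hV, ← hmapG s hsv] using hms)
    (by have : (-(s : ℝ) - -(v : ℝ)) = (v : ℝ) - s := by ring
        rw [this]; exact hsmall)
    (-r) ⟨by simp only [neg_le_neg_iff]; exact_mod_cast hrv, by simp only [neg_le_neg_iff]; exact_mod_cast hsr⟩
  simp only [hf, hV, neg_neg, Real.toNNReal_coe] at key
  rw [hmapG r hrv, hmapG s hsv]
  refine ⟨key.1, ?_⟩
  rw [norm_sub_rev]
  convert key.2 using 1
  ring

/-! ### The cocycle of slid hulls -/

/-- **The cocycle `B_{s+u} = (B_s slid by the shifted driver)`**: for `A` alive at time `s + u`,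
`slidHull W A (s + u) = slidHull (W(s+·) - W_s) (slidHull W A s) u` (Lawler's
`g_{s+u} = g_{s,s+u} ∘ g_s` and translation invariance of the Loewner equation).
[cite: Lawler2005, Rem. 4.9] -/
theorem slidHull_add (hW : Continuous W) {s u : ℝ≥0}
    (hA : ∀ a ∈ A, ((s + u : ℝ≥0) : WithTop ℝ≥0) < swallowingTime W a) :
    slidHull W A (s + u) = slidHull (fun r ↦ W (s + r) - W s) (slidHull W A s) u := by
  have hWs : Continuous fun r ↦ W (s + r) := continuous_shift W hW s
  have key : ∀ a ∈ A, map (fun r ↦ W (s + r) - W s) u (map W s a - W s) = map W (s + u) a - W s := by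
    intro a ha
    obtain ⟨halive, hmap⟩ := map_add hW (hA a ha)
    have := map_add_const hWs (-W s) halive
    simp only [Complex.ofReal_neg, ← sub_eq_add_neg] at this
    rw [this, hmap]
  ext w
  simp only [mem_slidHull_iff]
  constructor
  · rintro ⟨a, ha, rfl⟩
    refine ⟨map W s a - W s, ⟨a, ha, rfl⟩, ?_⟩
    rw [key a ha]
    push_cast
    ring
  · rintro ⟨b, ⟨a, ha, rfl⟩, rfl⟩
    refine ⟨a, ha, ?_⟩
    rw [key a ha]
    push_cast
    ring

/-- The shifted driver is continuous, vanishes at `0`, and its oscillation on `[0, u]` is that of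
`W` on `[s, s + u]`. [folklore] -/
theorem continuous_shiftDriver (hW : Continuous W) (s : ℝ≥0) :
    Continuous (fun r ↦ W (s + r) - W s) ∧ (fun r ↦ W (s + r) - W s) 0 = 0 :=
  ⟨(continuous_shift W hW s).sub continuous_const, by simp⟩

/-! ### Consequences for the hulls -/

/-- **The hull moves little, backward in time**: if `m ≤ infDist 0 B_s` (`m > 0`), `v ≤ s`,
all points of `A` are alive at time `s`, and `4(s - v)/m + osc_{[v,s]} W < m/2`, then every point
of `B_v` is within `4(s - v)/m + osc` of `B_s`, and `infDist 0 B_v ≥ m/2`.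
[cite: Lawler2005, Lemma 4.13] -/
theorem slidHull_near_of_before (hW : Continuous W) {s v : ℝ≥0} (hvs : v ≤ s)
    (hA : ∀ a ∈ A, ((s : ℝ≥0) : WithTop ℝ≥0) < swallowingTime W a) {m Ω : ℝ} (hm : 0 < m)
    (hms : m ≤ infDist 0 (slidHull W A s)) (hΩ : ∀ r : ℝ≥0, v ≤ r → r ≤ s → |W r - W s| ≤ Ω)
    (hsmall : 4 * ((s : ℝ) - v) / m + Ω < m / 2) :
    (∀ w ∈ slidHull W A v, infDist w (slidHull W A s) ≤ 4 / m * ((s : ℝ) - v) + Ω) ∧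
      (A.Nonempty → m / 2 ≤ infDist 0 (slidHull W A v)) := by
  have hpt : ∀ a ∈ A, m ≤ ‖map W s a - W s‖ := fun a ha ↦ by
    have hmem : map W s a - W s ∈ slidHull W A s := mem_slidHull_iff.2 ⟨a, ha, rfl⟩
    have := infDist_le_dist_of_mem (x := (0 : ℂ)) hmem
    rw [dist_comm, dist_zero_right] at this
    exact hms.trans this
  have hΩ0 : 0 ≤ Ω := (abs_nonneg _).trans (hΩ s hvs le_rfl)
  refine ⟨fun w hw ↦ ?_, fun hne ↦ ?_⟩
  · obtain ⟨a, ha, rfl⟩ := hw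
    obtain ⟨-, hmove⟩ := norm_map_sub_ge_of_before hW (hA a ha) hm (hpt a ha) hΩ hsmall le_rfl hvs
    have hmem : map W s a - W s ∈ slidHull W A s := mem_slidHull_iff.2 ⟨a, ha, rfl⟩
    refine (infDist_le_dist_of_mem hmem).trans ?_
    rw [dist_eq_norm]
    calc ‖map W v a - W v - (map W s a - W s)‖ = ‖-(map W s a - map W v a) + ((W s : ℂ) - W v)‖ := by ring_nf
      _ ≤ ‖-(map W s a - map W v a)‖ + ‖((W s - W v : ℝ) : ℂ)‖ := by push_cast; exact norm_add_le _ _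
      _ ≤ 4 / m * ((s : ℝ) - v) + Ω := by
          rw [norm_neg, Complex.norm_real, Real.norm_eq_abs, abs_sub_comm]
          exact add_le_add hmove (hΩ v le_rfl hvs)
  · have hne' : (slidHull W A v).Nonempty := hne.image _
    rw [infDist_eq_iInf]
    haveI : Nonempty (slidHull W A v) := hne'.to_subtype
    refine le_ciInf fun ⟨w, hw⟩ ↦ ?_
    obtain ⟨a, ha, rfl⟩ := hw
    obtain ⟨hfar, -⟩ := norm_map_sub_ge_of_before hW (hA a ha) hm (hpt a ha) hΩ hsmall le_rfl hvs
    rw [dist_comm, dist_zero_right]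
    exact hfar.le

/-- **The hull moves little, forward in time**: the same conclusions for `s ≤ v` with all points
of `A` alive at time `v` and `4(v - s)/m + osc_{[s,v]} W < m/2`. [cite: Lawler2005, Lemma 4.13] -/
theorem slidHull_near_of_after (hW : Continuous W) {s v : ℝ≥0} (hsv : s ≤ v)
    (hA : ∀ a ∈ A, ((v : ℝ≥0) : WithTop ℝ≥0) < swallowingTime W a) {m Ω : ℝ} (hm : 0 < m)
    (hms : m ≤ infDist 0 (slidHull W A s)) (hΩ : ∀ r : ℝ≥0, s ≤ r → r ≤ v → |W r - W s| ≤ Ω)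
    (hsmall : 4 * ((v : ℝ) - s) / m + Ω < m / 2) :
    (∀ w ∈ slidHull W A v, infDist w (slidHull W A s) ≤ 4 / m * ((v : ℝ) - s) + Ω) ∧
      (A.Nonempty → m / 2 ≤ infDist 0 (slidHull W A v)) := by
  have hpt : ∀ a ∈ A, m ≤ ‖map W s a - W s‖ := fun a ha ↦ by
    have hmem : map W s a - W s ∈ slidHull W A s := mem_slidHull_iff.2 ⟨a, ha, rfl⟩
    have := infDist_le_dist_of_mem (x := (0 : ℂ)) hmem
    rw [dist_comm, dist_zero_right] at this
    exact hms.trans this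
  refine ⟨fun w hw ↦ ?_, fun hne ↦ ?_⟩
  · obtain ⟨a, ha, rfl⟩ := hw
    obtain ⟨-, hmove⟩ := norm_map_sub_ge_of_after hW hsv (hA a ha) hm (hpt a ha) hΩ hsmall hsv le_rfl
    have hmem : map W s a - W s ∈ slidHull W A s := mem_slidHull_iff.2 ⟨a, ha, rfl⟩
    refine (infDist_le_dist_of_mem hmem).trans ?_
    rw [dist_eq_norm]
    calc ‖map W v a - W v - (map W s a - W s)‖ = ‖(map W v a - map W s a) + -(((W v : ℂ)) - W s)‖ := by ring_nf
      _ ≤ ‖map W v a - map W s a‖ + ‖-(((W v - W s : ℝ) : ℂ))‖ := by push_cast; exact norm_add_le _ _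
      _ ≤ 4 / m * ((v : ℝ) - s) + Ω := by
          rw [norm_neg, Complex.norm_real, Real.norm_eq_abs]
          exact add_le_add hmove (hΩ v hsv le_rfl)
  · have hne' : (slidHull W A v).Nonempty := hne.image _
    rw [infDist_eq_iInf]
    haveI : Nonempty (slidHull W A v) := hne'.to_subtype
    refine le_ciInf fun ⟨w, hw⟩ ↦ ?_
    obtain ⟨a, ha, rfl⟩ := hw
    obtain ⟨hfar, -⟩ := norm_map_sub_ge_of_after hW hsv (hA a ha) hm (hpt a ha) hΩ hsmall hsv le_rfl
    rw [dist_comm, dist_zero_right]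
    exact hfar.le

end Loewner

end Literature.Probability.RandomPlanarGeometry
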